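import Summits.Ventures.PercRepro.LemmaBAbstract

/-!
# PercRepro — the column-sum lemma: Lemma B for ≤ 2 types, abstractly (typer-2, gen 2)

p1's column-sum lemma (INBOX 2026-08-22T02:43:23Z; p4's Harris instance; p3's two-type case):
for a crossing family `x`, a monotone `c` and a cell `k`, the bad members lying in cell `k`
(`c A = x k`, `c Aᶜ` another cell) are at most the good pairs. Proof: the within-cell differences
`A \ B` of two such members are `(⊥, ⊤)` antipodal members (`c(A ⊓ Bᶜ) ≤ x k ⊓ x i = ⊥`,
`c(Aᶜ ⊔ B) ≥ x i' ⊔ x k = ⊤`), and Marica–Schönheim (`Finset.card_le_card_diffs`, Mathlib) gives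
`|P| ≤ |P \\ P|`. Consequences: `2·crossCount ≤ r·topBotCount` for any family of `r` cells, and
**Lemma B whenever every bad pair touches one fixed cell** (the one- and two-type cases); the
three-type case of `LemmaBAbstract` (`r = 3`, all three unordered types present) is the open core.
-/

namespace PercRepro

open Finset
open scoped FinsetFamily

section ColumnSum

variable {S : Type} [Fintype S] [DecidableEq S] {k r : ℕ} (x : Fin r → Setoid (Fin k))
  (c : Config S → Setoid (Fin k))

open Classical in
/-- The bad members lying in cell `i`: `c A = x i` and `c Aᶜ` another cell of the family. -/
noncomputable def columnSet (i : Fin r) : Finset (Config S) :=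
  Finset.univ.filter fun A => c A = x i ∧ ∃ j : Fin r, j ≠ i ∧ c Aᶜ = x j

/-- The size of the column of cell `i` (p1's `c_k`). -/
noncomputable def columnCount (i : Fin r) : ℕ := (columnSet x c i).card

open Classical in
/-- A within-column difference `A \ B` is the `⊥`-member of a `{⊤, ⊥}` antipodal pair. -/
theorem compl_sdiff_mem_goodSet (hx : IsCrossingFamily x) (hc : Monotone c) {i : Fin r}
    {A B : Config S} (hA : A ∈ columnSet x c i) (hB : B ∈ columnSet x c i) :
    (A \ B)ᶜ ∈ goodSet c := by
  simp only [columnSet, Finset.mem_filter, Finset.mem_univ, true_and] at hA hB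
  obtain ⟨hA1, j, hji, hA2⟩ := hA
  obtain ⟨hB1, j', hj'i, hB2⟩ := hB
  simp only [goodSet, Finset.mem_filter, Finset.mem_univ, true_and, compl_compl]
  constructor
  · -- `(A \ B)ᶜ = Aᶜ ⊔ B` has cell `⊤`
    refine top_unique ?_
    rw [sdiff_eq, compl_inf, compl_compl, ← hx.sup_eq_top hji, ← hA2, ← hB1]
    exact sup_le (hc le_sup_left) (hc le_sup_right)
  · -- `A \ B = A ⊓ Bᶜ` has cell `⊥`
    refine le_bot_iff.1 ?_
    rw [sdiff_eq, ← hx.inf_eq_bot hj'i.symm, ← hA1, ← hB2]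
    exact le_inf (hc inf_le_left) (hc inf_le_right)

open Classical in
/-- **The column-sum lemma**: the bad members of one cell are at most the good pairs
(Marica–Schönheim on the column, differences are `{⊤, ⊥}` pairs). -/
theorem columnCount_le_topBotCount (hx : IsCrossingFamily x) (hc : Monotone c) (i : Fin r) :
    columnCount x c i ≤ topBotCount c := by
  have h1 : columnCount x c i ≤ (columnSet x c i \\ columnSet x c i).card :=
    Finset.card_le_card_diffs _
  have h2 : (columnSet x c i \\ columnSet x c i).card ≤ (goodSet c).card := by
    rw [← Finset.card_image_of_injective (columnSet x c i \\ columnSet x c i) compl_injective]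
    refine Finset.card_le_card ?_
    intro D hD
    obtain ⟨D', hD', rfl⟩ := Finset.mem_image.1 hD
    obtain ⟨A, hA, B, hB, rfl⟩ := Finset.mem_diffs.1 hD'
    exact compl_sdiff_mem_goodSet x c hx hc hA hB
  exact h1.trans h2

open Classical in
/-- Each column is the union of the crossing classes `crossFam x c i j`, `j ≠ i`. -/
theorem columnSet_eq_biUnion (i : Fin r) :
    columnSet x c i = (Finset.univ.erase i).biUnion fun j => crossFam x c i j := by
  ext A
  simp only [columnSet, Finset.mem_filter, Finset.mem_univ, true_and, Finset.mem_biUnion,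
    Finset.mem_erase, mem_crossFam, and_true]
  constructor
  · rintro ⟨h1, j, hji, h2⟩
    exact ⟨j, hji, hji.symm, h1, h2⟩
  · rintro ⟨j, hji, -, h1, h2⟩
    exact ⟨h1, j, hji, h2⟩

open Classical in
/-- The column of cell `i` is the disjoint union of the classes `crossFam x c i j`. -/
theorem columnCount_eq_sum (hx : Function.Injective x) (i : Fin r) :
    columnCount x c i = ∑ j ∈ Finset.univ.erase i, (crossFam x c i j).card := by
  have hdisj : ∀ j ∈ Finset.univ.erase i, ∀ j' ∈ Finset.univ.erase i, j ≠ j' →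
      Disjoint (crossFam x c i j) (crossFam x c i j') := by
    intro j _ j' _ hjj'
    rw [Finset.disjoint_left]
    intro A hA hA'
    obtain ⟨-, -, h2⟩ := (mem_crossFam x c).1 hA
    obtain ⟨-, -, h2'⟩ := (mem_crossFam x c).1 hA'
    exact hjj' (hx (h2.symm.trans h2'))
  rw [columnCount, columnSet_eq_biUnion, Finset.card_biUnion hdisj]

/-- The crossing classes are symmetric in size (`crossFam_swap`). -/
theorem card_crossFam_comm (i j : Fin r) : (crossFam x c i j).card = (crossFam x c j i).card := by
  rw [crossFam_swap x c i j, Finset.card_image_of_injective _ compl_injective]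

open Classical in
/-- Counting every bad pair from both ends: `2·crossCount = Σ_i columnCount i`. -/
theorem two_mul_crossCount_eq_sum_columnCount (hx : Function.Injective x) :
    2 * crossCount x c = ∑ i : Fin r, columnCount x c i := by
  rw [crossCount_eq_sum x c hx]
  simp only [columnCount_eq_sum x c hx]
  have key : ∀ i : Fin r, ∑ j ∈ Finset.univ.erase i, (crossFam x c i j).card =
      ∑ j : Fin r, (if i < j then (crossFam x c i j).card else 0) +
        ∑ j : Fin r, (if j < i then (crossFam x c j i).card else 0) := by
    intro i
    rw [← Finset.sum_add_distrib]
    rw [Finset.sum_erase Finset.univ (by rw [crossFam_self, Finset.card_empty])]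
    refine Finset.sum_congr rfl fun j _ => ?_
    rcases lt_trichotomy i j with h | h | h
    · rw [if_pos h, if_neg (lt_asymm h), add_zero]
    · subst h
      simp [crossFam_self]
    · rw [if_neg (lt_asymm h), if_pos h, zero_add, card_crossFam_comm]
  simp only [key, Finset.sum_add_distrib]
  rw [Finset.sum_comm (f := fun i j => if j < i then (crossFam x c j i).card else 0)]
  ring

/-- **`2·crossCount ≤ r·topBotCount`** for any crossing family of `r` cells (p1's `2b ≤ 3g`). -/
theorem two_mul_crossCount_le (hx : IsCrossingFamily x) (hc : Monotone c) :
    2 * crossCount x c ≤ r * topBotCount c := by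
  rw [two_mul_crossCount_eq_sum_columnCount x c hx.injective]
  calc ∑ i : Fin r, columnCount x c i ≤ ∑ _i : Fin r, topBotCount c :=
        Finset.sum_le_sum fun i _ => columnCount_le_topBotCount x c hx hc i
    _ = r * topBotCount c := by simp

open Classical in
/-- **Lemma B when every bad pair touches one cell** (the one- and two-type cases): if no bad pair
avoids cell `i`, sending each bad pair to its member in column `i` is an injection into the column,
so `crossCount ≤ columnCount i ≤ topBotCount`. -/
theorem crossCount_le_topBotCount_of_column (hx : IsCrossingFamily x) (hc : Monotone c)
    (i : Fin r) (h : ∀ j j' : Fin r, j ≠ i → j' ≠ i → crossFam x c j j' = ∅) :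
    crossCount x c ≤ topBotCount c := by
  refine le_trans ?_ (columnCount_le_topBotCount x c hx hc i)
  rw [crossCount, columnCount]
  refine Finset.card_le_card_of_injOn (fun A => if c A = x i then A else Aᶜ) ?_ ?_
  · intro A hA
    simp only [Finset.coe_filter, Finset.mem_univ, true_and, Set.mem_setOf_eq] at hA
    obtain ⟨j, j', hjj', h1, h2⟩ := hA
    simp only [columnSet, Finset.coe_filter, Finset.mem_univ, true_and, Set.mem_setOf_eq]
    by_cases hj : j = i
    · subst hj
      rw [if_pos h1]
      exact ⟨h1, j', hjj'.ne', h2⟩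
    · by_cases hj' : j' = i
      · subst hj'
        have hne : c A ≠ x j' := by
          rw [h1]
          exact fun e => hj (hx.injective e)
        rw [if_neg hne]
        exact ⟨h2, j, hj, by rw [compl_compl]; exact h1⟩
      · exfalso
        have hmem : A ∈ crossFam x c j j' := (mem_crossFam x c).2 ⟨hjj'.ne, h1, h2⟩
        rw [h j j' hj hj'] at hmem
        exact Finset.notMem_empty _ hmem
  · intro A hA B hB hAB
    simp only [Finset.coe_filter, Finset.mem_univ, true_and, Set.mem_setOf_eq] at hA hB
    obtain ⟨j, j', hjj', h1, h2⟩ := hA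
    obtain ⟨l, l', hll', h3, h4⟩ := hB
    simp only at hAB
    split_ifs at hAB with hA' hB'
    · exact hAB
    · -- `A = Bᶜ`: the pair is read from both ends with reversed orders, impossible
      exfalso
      subst hAB
      rw [compl_compl] at h2
      have e1 := hx.injective (h1.symm.trans h4)
      have e2 := hx.injective (h2.symm.trans h3)
      subst e1 e2
      exact lt_asymm hjj' hll'
    · exfalso
      subst hAB
      rw [compl_compl] at h4
      have e1 := hx.injective (h1.symm.trans h4)
      have e2 := hx.injective (h2.symm.trans h3)
      subst e1 e2
      exact lt_asymm hjj' hll'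
    · exact compl_injective hAB

end ColumnSum

/-! ### The coloured Marica–Schönheim statement (MS3), the set-theoretic core -/

section MS

variable {S : Type} [Fintype S] [DecidableEq S]

open Classical in
/-- The union of the within-class differences `{y \ x : x, y ∈ C_i}` of a colouring `κ` of `T`. -/
noncomputable def classDiffs {r : ℕ} (T : Finset (Config S)) (κ : Config S → Fin r) :
    Finset (Config S) :=
  Finset.univ.biUnion fun i => (T.filter fun A => κ A = i) \\ (T.filter fun A => κ A = i)

/-- **Coloured Marica–Schönheim with `r` colours** (lead 02:37:32Z / 02:40:55Z, p3 §3 reduced form):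
for every complement-closed family `T` of subsets of a finite set and every `r`-colouring `κ` of `T`
giving complementary members different colours, `2·|⋃_i {y \ x : x, y ∈ C_i}| ≥ |T|`.
`r = 2` is Marica–Schönheim; `r = 3` (`MS3`) is the set-theoretic core of C-005; `r = 4` is FALSE. -/
def MSr (r : ℕ) : Prop :=
  ∀ {S : Type} [Fintype S] [DecidableEq S] (T : Finset (Config S)) (κ : Config S → Fin r),
    (∀ A ∈ T, Aᶜ ∈ T) → (∀ A ∈ T, κ Aᶜ ≠ κ A) → T.card ≤ 2 * (classDiffs T κ).card

/-- **MS3**: the three-colour Marica–Schönheim statement. -/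
def MS3 : Prop := MSr 3

variable {k r : ℕ} [NeZero r] (x : Fin r → Setoid (Fin k)) (c : Config S → Setoid (Fin k))

open Classical in
/-- The bad members of a map: both members of every distinct-cell antipodal pair. -/
noncomputable def badMembers : Finset (Config S) :=
  Finset.univ.filter fun A => ∃ i j : Fin r, i ≠ j ∧ c A = x i ∧ c Aᶜ = x j

open Classical in
/-- The colour of a configuration: the index of its cell (`0` if it lies in no cell). -/
noncomputable def cellColour (A : Config S) : Fin r :=
  if h : ∃ i : Fin r, c A = x i then Classical.choose h else 0

omit [Fintype S] [DecidableEq S] in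
/-- The colour of a member of cell `i` is `i`. -/
theorem cellColour_eq (hx : Function.Injective x) {A : Config S} {i : Fin r} (hA : c A = x i) :
    cellColour x c A = i := by
  unfold cellColour
  rw [dif_pos ⟨i, hA⟩]
  exact hx ((Classical.choose_spec (⟨i, hA⟩ : ∃ i, c A = x i)).symm.trans hA)

omit [NeZero r] in
open Classical in
/-- The bad members are complement-closed. -/
theorem compl_mem_badMembers {A : Config S} (hA : A ∈ badMembers x c) : Aᶜ ∈ badMembers x c := by
  simp only [badMembers, Finset.mem_filter, Finset.mem_univ, true_and, compl_compl] at hA ⊢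
  obtain ⟨i, j, hij, h1, h2⟩ := hA
  exact ⟨j, i, hij.symm, h2, h1⟩

open Classical in
/-- Complementary bad members have different colours. -/
theorem cellColour_compl_ne (hx : Function.Injective x) {A : Config S}
    (hA : A ∈ badMembers x c) : cellColour x c Aᶜ ≠ cellColour x c A := by
  simp only [badMembers, Finset.mem_filter, Finset.mem_univ, true_and] at hA
  obtain ⟨i, j, hij, h1, h2⟩ := hA
  rw [cellColour_eq x c hx h1, cellColour_eq x c hx h2]
  exact hij.symm

omit [NeZero r] in
open Classical in
/-- The bad members are the distinct-cell pairs read from both ends: `2·crossCount`. -/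
theorem card_badMembers (hx : Function.Injective x) :
    (badMembers x c).card = 2 * crossCount x c := by
  set C := Finset.univ.filter fun ρ : Config S =>
    ∃ i j : Fin r, i < j ∧ c ρ = x i ∧ c ρᶜ = x j with hC
  set C' := Finset.univ.filter fun ρ : Config S =>
    ∃ i j : Fin r, i < j ∧ c ρᶜ = x i ∧ c ρ = x j with hC'
  have hD : badMembers x c = C ∪ C' := by
    ext ρ
    simp only [badMembers, hC, hC', Finset.mem_filter, Finset.mem_univ, true_and,
      Finset.mem_union]
    constructor
    · rintro ⟨i, j, hij, h1, h2⟩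
      rcases lt_or_gt_of_ne hij with h | h
      · exact Or.inl ⟨i, j, h, h1, h2⟩
      · exact Or.inr ⟨j, i, h, h2, h1⟩
    · rintro (⟨i, j, hij, h1, h2⟩ | ⟨i, j, hij, h1, h2⟩)
      · exact ⟨i, j, hij.ne, h1, h2⟩
      · exact ⟨j, i, hij.ne', h2, h1⟩
  have hdisj : Disjoint C C' := by
    rw [Finset.disjoint_left]
    intro ρ h1 h2
    simp only [hC, hC', Finset.mem_filter, Finset.mem_univ, true_and] at h1 h2
    obtain ⟨a, b, hab, ha, hb⟩ := h1
    obtain ⟨a', b', hab', ha', hb'⟩ := h2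
    have e1 := hx (ha.symm.trans hb')
    have e2 := hx (hb.symm.trans ha')
    subst e1 e2
    exact absurd (hab.trans hab') (lt_irrefl _)
  have hC'card : C'.card = C.card := by
    rw [hC', hC]
    refine Finset.card_bij (fun ρ _ => ρᶜ) ?_ ?_ ?_
    · intro ρ hρ
      simp only [Finset.mem_filter, Finset.mem_univ, true_and] at hρ ⊢
      obtain ⟨i, j, hij, h1, h2⟩ := hρ
      exact ⟨i, j, hij, h1, by rw [compl_compl]; exact h2⟩
    · intro ρ _ ρ' _ h
      exact compl_injective h
    · intro ρ hρ
      refine ⟨ρᶜ, ?_, compl_compl ρ⟩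
      simp only [Finset.mem_filter, Finset.mem_univ, true_and] at hρ ⊢
      obtain ⟨i, j, hij, h1, h2⟩ := hρ
      exact ⟨i, j, hij, by rw [compl_compl]; exact h1, h2⟩
  rw [hD, Finset.card_union_of_disjoint hdisj, hC'card, crossCount]
  ring

open Classical in
/-- Within-colour differences of bad members are complements of good members. -/
theorem classDiffs_subset (hx : IsCrossingFamily x) (hc : Monotone c) :
    classDiffs (badMembers x c) (cellColour x c) ⊆ (goodSet c).image compl := by
  intro D hD
  obtain ⟨i, -, hD⟩ := Finset.mem_biUnion.1 hD
  obtain ⟨A, hA, B, hB, rfl⟩ := Finset.mem_diffs.1 hD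
  have key : ∀ {A : Config S}, A ∈ (badMembers x c).filter (fun A => cellColour x c A = i) →
      A ∈ columnSet x c i := by
    intro A hA
    rw [Finset.mem_filter] at hA
    obtain ⟨hA1, hA2⟩ := hA
    simp only [badMembers, Finset.mem_filter, Finset.mem_univ, true_and] at hA1
    obtain ⟨i', j, hij, h1, h2⟩ := hA1
    rw [cellColour_eq x c hx.injective h1] at hA2
    subst hA2
    simp only [columnSet, Finset.mem_filter, Finset.mem_univ, true_and]
    exact ⟨h1, j, hij.symm, h2⟩
  refine Finset.mem_image.2 ⟨(A \ B)ᶜ, compl_sdiff_mem_goodSet x c hx hc (key hA) (key hB), ?_⟩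
  rw [compl_compl]

/-- **Coloured Marica–Schönheim implies Lemma B for every crossing family of `r` cells.** -/
theorem LemmaBFamily_of_MSr (hx : IsCrossingFamily x) (h : MSr r) : LemmaBFamily x := by
  intro S _ _ c hc
  classical
  have h1 := h (badMembers x c) (cellColour x c) (fun A hA => compl_mem_badMembers x c hA)
    (fun A hA => cellColour_compl_ne x c hx.injective hA)
  rw [card_badMembers x c hx.injective] at h1
  have h2 : (classDiffs (badMembers x c) (cellColour x c)).card ≤ topBotCount c := by
    rw [topBotCount_eq_card_goodSet, ← Finset.card_image_of_injective (goodSet c) compl_injective]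
    exact Finset.card_le_card (classDiffs_subset x c hx hc)
  omega

/-- **MS3 implies the abstract Lemma B** (four indices, the three crossing partitions). -/
theorem LemmaBAbstract_of_MS3 (h : MS3) : LemmaBAbstract :=
  LemmaBFamily_of_MSr cross4 cross4_isCrossingFamily h

end MS

end PercRepro
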